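import Summits.ABC.ABC.Theses.GaussianTwoDivision
import Summits.ABC.ABC.Theses.CuspFieldPencil
import Summits.ABC.ABC.Theorems.CuspFieldPencilGoldenFromNFPencil
import Summits.ABC.ABC.Theorems.CuspFieldPencilNFPencilOfScoones
import Summits.ABC.ABC.Theorems.GaussianTwoDivisionGaussianPayoff
import Summits.ABC.ABC.Theorems.TwoTorsionDictionary
import Literature.NumberTheory.NumberFields.CyclotomicFieldFourClassNumber
import Literature.NumberTheory.ComplexMultiplication.CMTypeCount
import HarnessLib

/-!
# The Gaussian instance: number-field pencil theorem ⇒ Gaussian norm-form triple bound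

`Summits/ABC/ABC/Theorems/GaussianTwoDivisionOfNFPencil.lean` — helper toward the crux
stmt-ABC-23401 `Summit.ABC.ABC.Theses.GaussianTwoDivision.GaussianNormTripleBound` of the (draft)
class-record route `GaussianTwoDivision` (INPUTS-LIST row I-25, OPTION (ii); spec
`pub/abc-inputs/SPEC-I25-GAUSSIAN-CONSUMER.md`):

`NFPencilBound → GaussianNormTripleBound`   (`gaussianNormTripleBound_of_nfPencilBound`),

a pure transfer between two OPEN route items (stmt-ABC-26250 of route `CuspFieldPencil` and
stmt-ABC-23401), plus the by-name corollaries modulo the one printed input [Scoones2023, Thm 3]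
(`nfPencilBound_of_scoones2021`, ★ p617477): `gaussianNormTripleBound_of_scoones2021` and
`gaussianClassEpsShape_of_scoones2021` (target stmt-ABC-23400, via the closed items 23403 `GaussianPayoff`
and 23398 `TwoTorsionDictionary`).

**Proof** (template: the golden instance `goldenFromNFPencil_proof`, ★ p615723). Apply `NFPencilBound` to
`K = ℚ(i)`, modelled as Mathlib's `CyclotomicField 4 ℚ` (`[K:ℚ] = 2`: the tree's
`CMTypeCount.finrank_gaussianField`; class number one:
`Literature.NumberTheory.NumberFields.isPrincipalIdealRing_ringOfIntegers_cyclotomicField_four`), with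
`k = 3` and the pencil `L₀ = u + ζw`, `L₁ = u − ζw`, `L₂ = w` (`ζ² = −1`), pairwise non-proportional, with
`∏ Lᵢ = (u² + w²)·w`. From `a² + m² = 4b`, `gcd(a, b) = 1`, `m ≠ 0`: `a = 2u`, `m = 2w`, `b = u² + w²`,
`gcd(u, w) = 1`, `w ≠ 0`. NORM BOOKKEEPING (`Gᵢ = N(rad(Lᵢ𝓞_K))`): `G₂ ≤ rad(w)²`
(`GoldenFromNFPencil.absNorm_radical_span_intCast_le`); for the conjugate pair
`G₀G₁ = N(rad L₀ ⊔ rad L₁)·N(rad(L₀L₁))` (`GoldenFromNFPencil.absNorm_radical_mul_absNorm_radical`) with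
`L₀L₁ = u² + w² = b` and `2 ∈ (L₀, L₁)` (`su + tw = 1 ⇒ (s − tζ)L₀ + (s + tζ)L₁ = 2`), whence
`G₀G₁ ≤ N(2𝓞_K)·rad(b)²`; as `gcd(b, w) = 1`, `∏ Gᵢ ≤ N(2𝓞_K)·rad(bw)² ≤ N(2𝓞_K)·rad(bm)²`. The pencil
bound with `ε/2` gives `log max(|u|,|w|) ≤ C·(∏Gᵢ)^{1/3+ε/2} ≤ C⁺·N(2𝓞_K)^{1/3+ε/2}·rad(bm)^{2/3+ε}`, and
`log b ≤ log 2 + 2 log max(|u|,|w|)`; so `κ = log 2 + 2C⁺N(2𝓞_K)^{1/3+ε/2}`, `c₀ = 0`. The exponent is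
`2/3 = 2·(1/3)` because an inert prime `p ∣ Lᵢ` costs `p² = N(p𝓞_K)` (route file, l. 41).

PROOF-ONLY file (no definitions, no named facts, no `sorry`); serves stmt-ABC-23401 `--supports … --as helper`
WITHOUT closing it (23401, 23400 and 26250 stay OPEN as typed). HONESTY: bookkeeping theorem of a CLASS
RECORD at abc distance 0 (width 0): it specialises the OPEN, UNPROVED parametric number-field pencil theorem
`NFPencilBound`; the corollaries are PROVED-MOD-FACT {`scoones2021_abcNumberField_classNumberOne`};
NOT abc, NOT A-PS; abc moved by 0; typed ≠ proved; PROVED-MOD-FACT ≠ proved.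

References: Scoones, Mathematika 70 (2023) = arXiv:2111.07791 (only through `NFPencilBound` /
`nfPencilBound_of_scoones2021`); Fröhlich–Taylor Ch. IV §1 (`ℤ[i]` a PID); [folklore].
-/

set_option linter.dupNamespace false

namespace Summit.ABC.ABC.Theorems

open NumberField UniqueFactorizationMonoid

namespace GaussianOfNFPencil

/-! ## §1 Integer bookkeeping: `a² + m² = 4b`, `gcd(a,b) = 1` -/

/-- `a² + m² ≡ 0 (mod 4)` forces `a` and `m` even. [folklore] -/
theorem two_dvd_of_sq_add_sq_eq_four_mul {a m b : ℤ} (h : a ^ 2 + m ^ 2 = 4 * b) :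
    2 ∣ a ∧ 2 ∣ m := by
  have h4 : (a ^ 2 + m ^ 2) % 4 = 0 := by rw [h]; simp
  rcases Int.even_or_odd a with ha | ha <;> rcases Int.even_or_odd m with hm | hm
  · exact ⟨ha.two_dvd, hm.two_dvd⟩
  · exfalso
    obtain ⟨k, rfl⟩ := ha
    have h1 : m ^ 2 % 4 = 1 := Int.sq_mod_four_eq_one_of_odd hm
    have h2 : (k + k) ^ 2 = 4 * (k * k) := by ring
    omega
  · exfalso
    obtain ⟨k, rfl⟩ := hm
    have h1 : a ^ 2 % 4 = 1 := Int.sq_mod_four_eq_one_of_odd ha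
    have h2 : (k + k) ^ 2 = 4 * (k * k) := by ring
    omega
  · exfalso
    have h1 : a ^ 2 % 4 = 1 := Int.sq_mod_four_eq_one_of_odd ha
    have h2 : m ^ 2 % 4 = 1 := Int.sq_mod_four_eq_one_of_odd hm
    omega

/-- `gcd(2u, u² + w²) = 1 ⇒ gcd(u, w) = 1`. [folklore] -/
theorem isCoprime_of_isCoprime_two_mul {u w : ℤ} (h : IsCoprime (2 * u) (u ^ 2 + w ^ 2)) :
    IsCoprime u w := by
  obtain ⟨x, y, hxy⟩ := h
  exact ⟨2 * x + y * u, y * w, by linear_combination hxy⟩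

/-- `gcd(u, w) = 1 ⇒ gcd(u² + w², w) = 1`. [folklore] -/
theorem isRelPrime_sq_add_sq {u w : ℤ} (h : IsCoprime u w) : IsRelPrime (u ^ 2 + w ^ 2) w := by
  have h1 : IsCoprime (u ^ 2 + w * w) w := h.pow_left.add_mul_left_left w
  rw [← sq] at h1
  exact h1.isRelPrime

/-- `u² + w² ≤ 2·max(|u|,|w|)²`. [folklore] -/
theorem sq_add_sq_le_two_mul_max_sq (u w : ℤ) : u ^ 2 + w ^ 2 ≤ 2 * (max |u| |w|) ^ 2 := by
  have hu : u ^ 2 ≤ (max |u| |w|) ^ 2 := by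
    rw [← sq_abs u]; exact pow_le_pow_left₀ (abs_nonneg u) (le_max_left _ _) 2
  have hw : w ^ 2 ≤ (max |u| |w|) ^ 2 := by
    rw [← sq_abs w]; exact pow_le_pow_left₀ (abs_nonneg w) (le_max_right _ _) 2
  linarith

/-! ## §2 Ring identities for the pencil `u + ζw, u − ζw, w` (`ζ² = −1`) -/

/-- `(u + ζw)(u − ζw) = u² + w²` when `ζ² = −1`. [folklore] -/
theorem formZero_mul_formOne {R : Type*} [CommRing R] (ζ u w : R) (hζ : ζ * ζ = -1) :
    (1 * u + ζ * w) * (1 * u + -ζ * w) = u ^ 2 + w ^ 2 := by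
  linear_combination (-(w ^ 2)) * hζ

/-- The product of the three forms is `(u² + w²)·w`. [folklore] -/
theorem prod_forms {R : Type*} [CommRing R] (ζ u w : R) (hζ : ζ * ζ = -1) :
    ∏ i : Fin 3, ((![1, 1, 0] : Fin 3 → R) i * u + (![ζ, -ζ, 1] : Fin 3 → R) i * w) =
      (u ^ 2 + w ^ 2) * w := by
  rw [Fin.prod_univ_three]
  simp only [Matrix.cons_val_zero, Matrix.cons_val_one, Matrix.cons_val]
  linear_combination (-(w ^ 3)) * hζ

/-- `2 ∈ (u + ζw, u − ζw)` whenever `su + tw = 1`: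
`(s − tζ)(u + ζw) + (s + tζ)(u − ζw) = 2(su + tw) − 2t(ζ² + 1)w = 2`. [folklore] -/
theorem two_mem_sup {R : Type*} [CommRing R] (ζ u w s t : R) (hζ : ζ * ζ = -1)
    (hst : s * u + t * w = 1) :
    (2 : R) ∈ Ideal.span {1 * u + ζ * w} ⊔ Ideal.span {1 * u + -ζ * w} := by
  rw [Submodule.mem_sup]
  refine ⟨(s - t * ζ) * (1 * u + ζ * w), Ideal.mul_mem_left _ _ (Ideal.mem_span_singleton_self _),
    (s + t * ζ) * (1 * u + -ζ * w), Ideal.mul_mem_left _ _ (Ideal.mem_span_singleton_self _), ?_⟩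
  linear_combination 2 * hst + (-(2 * t * w)) * hζ

/-! ## §3 Real arithmetic -/

/-- Real-arithmetic step: from `L ≤ C · P^e` with `P ≤ C₀ · R²` (naturals), `e = 1/3 + ε/2 ≥ 0`,
deduce `L ≤ (max C 0 · C₀^e) · R^{2/3+ε}`. [folklore] -/
theorem real_step {L C ε : ℝ} {P C₀ R : ℕ} (hε : 0 < ε)
    (hL : L ≤ C * (P : ℝ) ^ (1 / (3 : ℝ) + ε / 2)) (hP : P ≤ C₀ * R ^ 2) :
    L ≤ (max C 0 * (C₀ : ℝ) ^ (1 / (3 : ℝ) + ε / 2)) * (R : ℝ) ^ (2 / 3 + ε : ℝ) := by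
  set e : ℝ := 1 / (3 : ℝ) + ε / 2 with he
  have he0 : 0 ≤ e := by rw [he]; positivity
  have hPR : (P : ℝ) ≤ (C₀ : ℝ) * (R : ℝ) ^ 2 := by exact_mod_cast hP
  have hPe : (P : ℝ) ^ e ≤ ((C₀ : ℝ) * (R : ℝ) ^ 2) ^ e :=
    Real.rpow_le_rpow (Nat.cast_nonneg _) hPR he0
  have hsplit : ((C₀ : ℝ) * (R : ℝ) ^ 2) ^ e = (C₀ : ℝ) ^ e * (R : ℝ) ^ (2 / 3 + ε : ℝ) := by
    rw [Real.mul_rpow (Nat.cast_nonneg _) (pow_nonneg (Nat.cast_nonneg _) 2)]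
    congr 1
    rw [show ((R : ℝ) ^ 2) = (R : ℝ) ^ (2 : ℝ) by norm_cast, ← Real.rpow_mul (Nat.cast_nonneg _)]
    congr 1
    rw [he]; ring
  have hPe0 : 0 ≤ (P : ℝ) ^ e := Real.rpow_nonneg (Nat.cast_nonneg _) e
  calc L ≤ C * (P : ℝ) ^ e := hL
    _ ≤ max C 0 * (P : ℝ) ^ e := mul_le_mul_of_nonneg_right (le_max_left _ _) hPe0
    _ ≤ max C 0 * (((C₀ : ℝ) * (R : ℝ) ^ 2) ^ e) :=
        mul_le_mul_of_nonneg_left hPe (le_max_right _ _)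
    _ = (max C 0 * (C₀ : ℝ) ^ e) * (R : ℝ) ^ (2 / 3 + ε : ℝ) := by rw [hsplit, mul_assoc]

/-- Final step: `log b ≤ log 2 + 2·log M`, `log M ≤ C'·R'^e`, `R' ≤ R`, `1 ≤ R`, `0 ≤ C'` give
`log b ≤ (log 2 + 2C')·R^e` (`e = 2/3 + ε > 0`). [folklore] -/
theorem final_step {b M C' e : ℝ} {R' R : ℕ} (he : 0 < e) (hC' : 0 ≤ C') (hM : 1 ≤ M) (hb0 : 0 < b)
    (hbM : b ≤ 2 * M ^ 2) (hlog : Real.log M ≤ C' * (R' : ℝ) ^ e) (hR : R' ≤ R) (hR1 : 1 ≤ R) :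
    Real.log b ≤ (Real.log 2 + 2 * C') * (R : ℝ) ^ e := by
  have hM0 : 0 < M := by linarith
  have h1 : Real.log b ≤ Real.log 2 + 2 * Real.log M := by
    calc Real.log b ≤ Real.log (2 * M ^ 2) := Real.log_le_log hb0 hbM
      _ = Real.log 2 + 2 * Real.log M := by
          rw [Real.log_mul (by norm_num) (by positivity), Real.log_pow]; norm_num
  have hRR : (R' : ℝ) ^ e ≤ (R : ℝ) ^ e :=
    Real.rpow_le_rpow (Nat.cast_nonneg _) (by exact_mod_cast hR) he.le
  have hRe1 : 1 ≤ (R : ℝ) ^ e := Real.one_le_rpow (by exact_mod_cast hR1) he.le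
  have h2 : Real.log M ≤ C' * (R : ℝ) ^ e := hlog.trans (mul_le_mul_of_nonneg_left hRR hC')
  have hlog2 : 0 ≤ Real.log 2 := Real.log_nonneg (by norm_num)
  nlinarith

/-! ## §4 The Gaussian instance of the pencil theorem (any model of `ℚ(i)`) -/

/-- **Pencil bound for `u + ζw, u − ζw, w` over a class-number-one quadratic field containing
`ζ` with `ζ² = −1`:** from `NFPencilBound`, for every `ε > 0` there is `C ≥ 0` with
`log max(|u|,|w|) ≤ C · rad((u² + w²)·w)^{2/3+ε}` for all coprime `u, w` with `w ≠ 0`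
(`∏ Gᵢ ≤ N(2𝓞_K)·rad((u²+w²)w)²`, exponent `1/3 + ε/2 ↦ 2/3 + ε`). [folklore] -/
theorem log_max_le_of_nfPencilBound (hNF : Summit.ABC.ABC.Theses.CuspFieldPencil.NFPencilBound)
    (K : Type) [Field K] [NumberField K] (hPID : IsPrincipalIdealRing (𝓞 K)) (ζ : 𝓞 K)
    (hζ : ζ * ζ = -1) (hdeg : Module.finrank ℚ K = 2) (ε : ℝ) (hε : 0 < ε) :
    ∃ C : ℝ, 0 ≤ C ∧ ∀ u w : ℤ, IsCoprime u w → w ≠ 0 →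
      Real.log ((max |u| |w| : ℤ) : ℝ) ≤
        C * (((radical ((u ^ 2 + w ^ 2) * w)).natAbs : ℕ) : ℝ) ^ (2 / 3 + ε : ℝ) := by
  unfold Summit.ABC.ABC.Theses.CuspFieldPencil.NFPencilBound at hNF
  -- non-vanishings in `𝓞 K`
  have hζ0 : ζ ≠ 0 := by
    rintro rfl
    norm_num at hζ
  have hneg : -ζ ≠ ζ := by
    intro h
    have h2 : (2 : 𝓞 K) * ζ = 0 := by linear_combination (-1 : 𝓞 K) * h
    rcases mul_eq_zero.1 h2 with h2 | h2
    · exact two_ne_zero h2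
    · exact hζ0 h2
  have h20 : (2 : 𝓞 K) ≠ 0 := two_ne_zero
  -- the forms
  let α : Fin 3 → 𝓞 K := ![1, 1, 0]
  let β : Fin 3 → 𝓞 K := ![ζ, -ζ, 1]
  have hprop : ∀ i j : Fin 3, i ≠ j → α i * β j ≠ α j * β i := by
    intro i j hij
    fin_cases i <;> fin_cases j <;>
      simp [α, β, hneg, hneg.symm] at hij ⊢
  obtain ⟨C, hC⟩ := hNF K hPID 3 α β (le_refl 3) hprop (ε / 2) (by positivity)
  -- the absolute constant `C₀ = N(2·𝓞_K)` (`= 4`, value not needed)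
  refine ⟨max C 0 * (Ideal.absNorm (Ideal.span {(2 : 𝓞 K)}) : ℝ) ^ (1 / (3 : ℝ) + ε / 2),
    by positivity, ?_⟩
  intro u w hcop hw
  have hb : u ^ 2 + w ^ 2 ≠ 0 := by positivity
  have hne : (u ^ 2 + w ^ 2) * w ≠ 0 := mul_ne_zero hb hw
  -- the product of the forms is `(u² + w²)·w ≠ 0`
  have hprod : ∏ i, (α i * (u : 𝓞 K) + β i * (w : 𝓞 K)) = (((u ^ 2 + w ^ 2) * w : ℤ) : 𝓞 K) := by
    rw [prod_forms ζ _ _ hζ]; push_cast; ring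
  have hprod0 : ∏ i, (α i * (u : 𝓞 K) + β i * (w : 𝓞 K)) ≠ 0 := by
    rw [hprod]; exact_mod_cast hne
  have hmain := hC u w hcop hprod0
  -- norm bookkeeping
  have hG : ∏ i, Ideal.absNorm (Ideal.span {α i * (u : 𝓞 K) + β i * (w : 𝓞 K)}).radical ≤
      Ideal.absNorm (Ideal.span {(2 : 𝓞 K)}) * (radical ((u ^ 2 + w ^ 2) * w)).natAbs ^ 2 := by
    rw [Fin.prod_univ_three]
    simp only [α, β, Matrix.cons_val_zero, Matrix.cons_val_one, Matrix.cons_val, one_mul, zero_mul,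
      zero_add]
    have hGw := GoldenFromNFPencil.absNorm_radical_span_intCast_le K w hw
    have hGb := GoldenFromNFPencil.absNorm_radical_span_intCast_le K _ hb
    rw [hdeg] at hGw hGb
    -- the conjugate pair
    obtain ⟨s, t, hst⟩ := hcop
    have hmem : (2 : 𝓞 K) ∈ Ideal.span {(u : 𝓞 K) + ζ * w} ⊔ Ideal.span {(u : 𝓞 K) + -ζ * w} := by
      have hst' : (s : 𝓞 K) * (u : 𝓞 K) + (t : 𝓞 K) * (w : 𝓞 K) = 1 := by
        rw [← Int.cast_mul, ← Int.cast_mul, ← Int.cast_add, hst, Int.cast_one]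
      have := two_mem_sup ζ (u : 𝓞 K) (w : 𝓞 K) _ _ hζ hst'
      simpa only [one_mul] using this
    have h2N : Ideal.absNorm (Ideal.span {(2 : 𝓞 K)}) ≠ 0 := by
      rw [Ne, Ideal.absNorm_eq_zero_iff, Ideal.span_singleton_eq_bot]; exact h20
    have hpair := GoldenFromNFPencil.absNorm_radical_mul_absNorm_radical
      (Ideal.span {(u : 𝓞 K) + ζ * w}) (Ideal.span {(u : 𝓞 K) + -ζ * w})
    have hsup := GoldenFromNFPencil.absNorm_sup_radical_le _ _ (2 : 𝓞 K) hmem h2N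
    have hIJ : Ideal.span {(u : 𝓞 K) + ζ * w} * Ideal.span {(u : 𝓞 K) + -ζ * w} =
        Ideal.span {((u ^ 2 + w ^ 2 : ℤ) : 𝓞 K)} := by
      rw [Ideal.span_singleton_mul_span_singleton]
      congr 2
      have := formZero_mul_formOne ζ (u : 𝓞 K) (w : 𝓞 K) hζ
      simp only [one_mul] at this
      rw [this]; push_cast; ring
    rw [hIJ] at hpair
    -- assemble in ℕ
    rw [radical_mul (isRelPrime_sq_add_sq ⟨s, t, hst⟩), Int.natAbs_mul]
    have h01 : Ideal.absNorm (Ideal.span {(u : 𝓞 K) + ζ * w}).radical *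
        Ideal.absNorm (Ideal.span {(u : 𝓞 K) + -ζ * w}).radical ≤
        Ideal.absNorm (Ideal.span {(2 : 𝓞 K)}) * (radical (u ^ 2 + w ^ 2)).natAbs ^ 2 := by
      rw [hpair]; exact Nat.mul_le_mul hsup hGb
    calc _ ≤ (Ideal.absNorm (Ideal.span {(2 : 𝓞 K)}) * (radical (u ^ 2 + w ^ 2)).natAbs ^ 2) *
          (radical w).natAbs ^ 2 := Nat.mul_le_mul h01 hGw
      _ = _ := by ring
  -- real arithmetic
  have hexp : (1 / ((3 : ℕ) : ℝ) + ε / 2) = (1 / (3 : ℝ) + ε / 2) := by norm_num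
  rw [hexp] at hmain
  exact real_step hε hmain hG

/-! ## §5 `ℚ(i)` as `CyclotomicField 4 ℚ` -/

/-- `𝓞_{ℚ(ζ₄)}` contains `ζ` with `ζ² = −1` (`ζ₄²` is a primitive square root of unity). [folklore] -/
theorem exists_sq_eq_neg_one :
    ∃ ζ : 𝓞 (CyclotomicField 4 ℚ), ζ * ζ = -1 := by
  haveI hcyc : IsCyclotomicExtension {4} ℚ (CyclotomicField 4 ℚ) :=
    CyclotomicField.isCyclotomicExtension 4 ℚ
  have hz := IsCyclotomicExtension.zeta_spec 4 ℚ (CyclotomicField 4 ℚ)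
  have h2 : IsPrimitiveRoot ((IsCyclotomicExtension.zeta 4 ℚ (CyclotomicField 4 ℚ)) ^ 2) 2 := by
    have := hz.pow_of_dvd (p := 2) two_ne_zero (by norm_num : 2 ∣ 4)
    norm_num at this
    exact this
  have hsq := h2.eq_neg_one_of_two_right
  refine ⟨⟨IsCyclotomicExtension.zeta 4 ℚ (CyclotomicField 4 ℚ), hz.isIntegral (by norm_num)⟩, ?_⟩
  ext
  simp only [map_mul, map_neg, map_one, RingOfIntegers.map_mk]
  rw [← sq, hsq]

end GaussianOfNFPencil

open GaussianOfNFPencil in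
/-- **The Gaussian norm-form triple bound from the number-field pencil theorem** (helper toward
stmt-ABC-23401; pure transfer between two OPEN route items, no named fact consumed):
`NFPencilBound → GaussianNormTripleBound`. For coprime `a, b` and `m ≠ 0` with `a² + m² = 4b`:
`a = 2u`, `m = 2w`, `b = u² + w²`, and the pencil theorem at `K = ℚ(i)` (`CyclotomicField 4 ℚ`, PID),
`k = 3`, forms `u ± ζw, w` gives `log b ≤ log 2 + 2 log max(|u|,|w|) ≤ κ·rad(bm)^{2/3+ε}` (`c₀ = 0`).
[folklore] -/
theorem gaussianNormTripleBound_of_nfPencilBound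
    (hNF : Summit.ABC.ABC.Theses.CuspFieldPencil.NFPencilBound) :
    Summit.ABC.ABC.Theses.GaussianTwoDivision.GaussianNormTripleBound := by
  unfold Summit.ABC.ABC.Theses.GaussianTwoDivision.GaussianNormTripleBound
  intro ε hε
  obtain ⟨ζ, hζ⟩ := exists_sq_eq_neg_one
  obtain ⟨C, hC0, hC⟩ := log_max_le_of_nfPencilBound hNF (CyclotomicField 4 ℚ)
    Literature.NumberTheory.NumberFields.isPrincipalIdealRing_ringOfIntegers_cyclotomicField_four
    ζ hζ Literature.NumberTheory.ComplexMultiplication.CMTypeCount.finrank_gaussianField ε hε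
  refine ⟨Real.log 2 + 2 * C, 0, ?_⟩
  intro a b m hab hm h _
  obtain ⟨⟨u, rfl⟩, ⟨w, rfl⟩⟩ := two_dvd_of_sq_add_sq_eq_four_mul h
  have hw : w ≠ 0 := by rintro rfl; exact hm (by ring)
  have hb : b = u ^ 2 + w ^ 2 := by
    have h4 : 4 * b = 4 * (u ^ 2 + w ^ 2) := by rw [← h]; ring
    exact mul_left_cancel₀ (by norm_num) h4
  have hcop : IsCoprime u w := isCoprime_of_isCoprime_two_mul (hb ▸ hab)
  have key := hC u w hcop hw
  -- `rad((u²+w²)·w) ≤ rad(b·m)`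
  have hbm : b * (2 * w) ≠ 0 := by
    rw [hb]; exact mul_ne_zero (by positivity) (by positivity)
  have hdvd : (u ^ 2 + w ^ 2) * w ∣ b * (2 * w) := ⟨2, by rw [hb]; ring⟩
  have hR : (radical ((u ^ 2 + w ^ 2) * w)).natAbs ≤ (radical (b * (2 * w))).natAbs :=
    Nat.le_of_dvd (Int.natAbs_pos.mpr radical_ne_zero)
      (Int.natAbs_dvd_natAbs.mpr (radical_dvd_radical hdvd hbm))
  have hR1 : 1 ≤ (radical (b * (2 * w))).natAbs := Int.natAbs_pos.mpr radical_ne_zero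
  -- sizes
  have hM1 : (1 : ℝ) ≤ ((max |u| |w| : ℤ) : ℝ) := by
    have : (1 : ℤ) ≤ max |u| |w| := le_max_of_le_right (Int.one_le_abs hw)
    exact_mod_cast this
  have hb0 : (0 : ℝ) < (b : ℝ) := by
    have : (0 : ℤ) < b := by rw [hb]; positivity
    exact_mod_cast this
  have hbM : (b : ℝ) ≤ 2 * ((max |u| |w| : ℤ) : ℝ) ^ 2 := by
    have := sq_add_sq_le_two_mul_max_sq u w
    rw [← hb] at this
    exact_mod_cast this
  exact final_step (by positivity) hC0 hM1 hb0 hbM key hR hR1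

/-- **The Gaussian norm-form triple bound modulo Scoones 2021, BY NAME** (helper toward stmt-ABC-23401,
which stays OPEN as typed): `scoones2021_abcNumberField_classNumberOne → GaussianNormTripleBound`, via
`nfPencilBound_of_scoones2021` (★ p617477). PROVED-MOD-FACT ≠ proved; not abc, abc moved by 0.
[cite: Scoones2023, Thm 3 + display p. 4 — by name] -/
theorem gaussianNormTripleBound_of_scoones2021
    (hS : Literature.NumberTheory.DiophantineGeometry.scoones2021_abcNumberField_classNumberOne) :
    Summit.ABC.ABC.Theses.GaussianTwoDivision.GaussianNormTripleBound :=
  gaussianNormTripleBound_of_nfPencilBound (nfPencilBound_of_scoones2021 hS)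

/-- **The Gaussian two-division class ε-shape (exponent `2/3`) modulo Scoones 2021, BY NAME**
(helper toward the target stmt-ABC-23400, which stays OPEN as typed): `gaussianPayoff_proof` (stmt-ABC-23403,
closed) applied to `gaussianNormTripleBound_of_scoones2021 hS` and the two-torsion dictionary
`gaussianTwoDivision_twoTorsionDictionary_proof` (stmt-ABC-23398, closed). ONE printed input, TWO class
rows (with `fiveTorsionClassEpsShape_of_scoones2021`). PROVED-MOD-FACT ≠ proved; not abc, abc moved by 0.
[cite: Scoones2023, Thm 3 + display p. 4 — by name] -/
theorem gaussianClassEpsShape_of_scoones2021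
    (hS : Literature.NumberTheory.DiophantineGeometry.scoones2021_abcNumberField_classNumberOne) :
    Summit.ABC.ABC.Theses.GaussianTwoDivision.GaussianClassEpsShape :=
  (show Summit.ABC.ABC.Theses.GaussianTwoDivision.GaussianNormTripleBound →
      Summit.ABC.ABC.Theses.GaussianTwoDivision.TwoTorsionDictionary →
      Summit.ABC.ABC.Theses.GaussianTwoDivision.GaussianClassEpsShape from gaussianPayoff_proof)
    (gaussianNormTripleBound_of_scoones2021 hS) gaussianTwoDivision_twoTorsionDictionary_proof

end Summit.ABC.ABC.Theorems
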